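import Summits.Ventures.HodgeRepro2.T5DecompositionCyclic
import Summits.Ventures.HodgeRepro2.T5CyclotomicSevenFrobenius
import Summits.Ventures.HodgeRepro2.T5CubicRamification
import Summits.Ventures.HodgeRepro2.T5ConjugationDecomposition

/-!
# T5CyclotomicSevenRamification — «for E = ℚ(ζ₇) only p = 7 ramifies; 7 = 𝔭⁶» (seat p3)

Kernel witnesses behind TWO lines already on the record: route/T5-N2-route-3.md v20 §N2.6
(N-T5N2.2) «in general D_p is the decomposition group of p in Gal(E/ℚ) … containing the inertia
group I_p (non-trivial iff p ramifies in E; for E = ℚ(ζ₇) only p = 7 ramifies)», and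
route/T5-route-3.md v0.31 §F.1 (iii) «for E = ℚ(ζ₇) the only place of F⁺ ramified in E is the one
above 7 (7 = 𝔭⁶)».

For ANY `E` with `IsCyclotomicExtension {7} ℚ E` (Galois over ℚ), ANY prime `P` of `𝓞 E` above a
rational prime `p`, and ANY cubic intermediate field `F` (the F⁺ of the brief), with
`𝔭 := P ∩ 𝓞 F`:

* `p ≠ 7`: `ramificationIdx_eq_one_of_ne_seven` (e = 1, Mathlib), `inertiaDeg_eq_orderOf_of_ne_seven`
  (f = ord_7(p)), `inertia_eq_bot_of_ne_seven` (I_P = ⊥, file 67),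
  `ramificationIdx_under_eq_one_of_ne_seven` (𝔭 is unramified in E, file 45's tower lemma);
* `p = 7`: `ramificationIdx_of_seven` (e = 6), `inertiaDeg_of_seven` (f = 1),
  `ncard_primesOver_of_seven` (one prime), `card_inertia_of_seven` (|I_P| = 6 = |Gal(E/ℚ)|),
  **`inertia_eq_top_of_seven`** and `stabilizer_eq_top_of_seven` (I_P = D_P = everything),
  **`ramificationIdx_under_of_seven`** (the tower e(P∣7) = e(𝔭∣7)·e(P∣𝔭) = 3·2 — «7 = 𝔭⁶»);
* the criteria **`inertia_eq_bot_iff`** (I_P = ⊥ ⟺ p ≠ 7) and **`ramificationIdx_under_eq_one_iff`**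
  (the place of F below P is unramified in E ⟺ p ≠ 7).

p5's `T5DegreeOneCounterexample` (e = 3, f = 1 at 7 in p1's concrete ℚ(ζ₇)⁺) is the N0 (D6)
witness and is not restated.  What stays prose: that the brief's sextic E is a ℚ(ζ₇) in the example
(an instantiation).  README §8(d): this file uses an L-value-free non-vanishing device: NO.
-/

namespace Summit.Ventures.HodgeRepro2.T5CyclotomicSevenRamification

open Ideal NumberField

/-- `7` is prime (as a `Fact`, for Mathlib's cyclotomic ramification theory). -/
instance fact_prime_seven : Fact (Nat.Prime 7) := ⟨by norm_num⟩

/-- The ideal `(7) ⊂ ℤ` is prime. -/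
instance isPrime_span_seven : (span {(7 : ℤ)}).IsPrime :=
  (Ideal.span_singleton_prime (by norm_num)).mpr (Nat.prime_iff_prime_int.mp (by norm_num))

open scoped Pointwise

variable {E : Type*} [Field E] [NumberField E] [IsCyclotomicExtension {7} ℚ E]

/-- `|Gal(E/ℚ)| = 6` for `E = ℚ(ζ₇)` (through file 70's `galEquiv : Gal(E/ℚ) ≃* (ℤ/7)ˣ`). -/
theorem card_gal : Nat.card Gal(E/ℚ) = 6 := by
  rw [Nat.card_congr (T5CyclotomicSevenFrobenius.galEquiv (E := E)).toEquiv, Nat.card_eq_fintype_card,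
    ZMod.card_units_eq_totient]
  decide

section ne_seven

variable {p : ℕ} (P : Ideal (𝓞 E)) [P.IsPrime] [P.LiesOver (span {(p : ℤ)})]

/-- A prime `p ≠ 7` does not divide `7`. -/
theorem not_dvd_seven (hp : p.Prime) (h7 : p ≠ 7) : ¬ p ∣ 7 :=
  (Nat.prime_dvd_prime_iff_eq hp (by norm_num)).not.mpr h7

/-- `p ≠ 7` is unramified in `ℚ(ζ₇)`: `e(P∣p) = 1`. -/
theorem ramificationIdx_eq_one_of_ne_seven (hp : p.Prime) (h7 : p ≠ 7) :
    P.ramificationIdx ℤ = 1 := by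
  haveI : Fact p.Prime := ⟨hp⟩
  exact IsCyclotomicExtension.Rat.ramificationIdx_eq_of_not_dvd p E P (not_dvd_seven hp h7)

/-- `p ≠ 7`: the residue degree is the order of `p` in `(ℤ/7)ˣ`. -/
theorem inertiaDeg_eq_orderOf_of_ne_seven (hp : p.Prime) (h7 : p ≠ 7) :
    P.inertiaDeg ℤ = orderOf (p : ZMod 7) := by
  haveI : Fact p.Prime := ⟨hp⟩
  exact IsCyclotomicExtension.Rat.inertiaDeg_eq_of_not_dvd p E P (not_dvd_seven hp h7)

/-- `p ≠ 7`: for any intermediate field `F`, the place `𝔭 = P ∩ 𝓞 F` is unramified in `E`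
(`e(P∣𝔭) = 1`) and `𝔭` is unramified over `p` (file 45's tower lemma). -/
theorem ramificationIdx_under_eq_one_of_ne_seven (hp : p.Prime) (h7 : p ≠ 7)
    (F : IntermediateField ℚ E) :
    (P.under (𝓞 F)).ramificationIdx ℤ = 1 ∧ P.ramificationIdx (𝓞 F) = 1 :=
  T5CyclotomicDyadic.ramificationIdx_eq_one_of_tower (P.under (𝓞 F)) P
    (ramificationIdx_eq_one_of_ne_seven P hp h7)

variable [IsGalois ℚ E]

/-- `p ≠ 7`: the inertia group of `P` in `Gal(E/ℚ)` is trivial (file 67). -/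
theorem inertia_eq_bot_of_ne_seven (hp : p.Prime) (h7 : p ≠ 7) : P.inertia Gal(E/ℚ) = ⊥ :=
  T5DecompositionCyclic.inertia_eq_bot_of_ramificationIdx_eq_one hp P
    (ramificationIdx_eq_one_of_ne_seven P hp h7)

end ne_seven

section seven

variable (P : Ideal (𝓞 E)) [P.IsPrime] [P.LiesOver (span {(7 : ℤ)})]

/-- `7` is totally ramified in `ℚ(ζ₇)`: `e(P∣7) = 6` (Mathlib). -/
theorem ramificationIdx_of_seven : P.ramificationIdx ℤ = 6 := by
  have := IsCyclotomicExtension.Rat.ramificationIdx_eq_of_prime 7 E P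
  simpa using this

/-- `f(P∣7) = 1` (Mathlib). -/
theorem inertiaDeg_of_seven : P.inertiaDeg ℤ = 1 :=
  IsCyclotomicExtension.Rat.inertiaDeg_eq_of_prime 7 E P

/-- There is exactly one prime of `ℚ(ζ₇)` above `7` (Mathlib). -/
theorem ncard_primesOver_of_seven : ((span {(7 : ℤ)}).primesOver (𝓞 E)).ncard = 1 :=
  IsCyclotomicExtension.Rat.ncard_primesOver_of_prime 7 E

variable [IsGalois ℚ E]

/-- `|D_P| = e·f = 6` at `7` (file 66). -/
theorem card_stabilizer_of_seven : Nat.card (MulAction.stabilizer Gal(E/ℚ) P) = 6 := by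
  rw [T5DecompositionOrder.card_stabilizer_eq_ramificationIdx_mul_inertiaDeg (p := 7) (by norm_num) P,
    ramificationIdx_of_seven, inertiaDeg_of_seven]

/-- The decomposition group at `7` is all of `Gal(E/ℚ)`. -/
theorem stabilizer_eq_top_of_seven : MulAction.stabilizer Gal(E/ℚ) P = ⊤ := by
  rw [← Subgroup.card_eq_iff_eq_top, card_stabilizer_of_seven, card_gal]

/-- `|I_P| = e = 6` at `7` (Mathlib's `card_inertia_eq_ramificationIdxIn`). -/
theorem card_inertia_of_seven : Nat.card (P.inertia Gal(E/ℚ)) = 6 := by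
  haveI := T5TameCongruence.isGaloisGroup_gal (F := E)
  rw [Ideal.card_inertia_eq_ramificationIdxIn (span {(7 : ℤ)}) P,
    Ideal.ramificationIdxIn_eq_ramificationIdx (span {(7 : ℤ)}) P Gal(E/ℚ), ramificationIdx_of_seven]

/-- THE INERTIA GROUP AT `7` IS EVERYTHING: `I_P = Gal(E/ℚ)` («non-trivial iff p ramifies»,
the ramified side). -/
theorem inertia_eq_top_of_seven : P.inertia Gal(E/ℚ) = ⊤ := by
  rw [← Subgroup.card_eq_iff_eq_top, card_inertia_of_seven, card_gal]

/-- The inertia group at `7` is not trivial. -/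
theorem inertia_ne_bot_of_seven : P.inertia Gal(E/ℚ) ≠ ⊥ := by
  rw [Ne, Subgroup.eq_bot_iff_card, card_inertia_of_seven]
  norm_num

omit [P.LiesOver (span {(7 : ℤ)})] in
/-- `e(P∣𝔭) ∣ 2` for a cubic intermediate field `F` (the fundamental identity over `𝓞 F` with
the group `Gal(E/F)` of order `2`). -/
theorem ramificationIdx_top_dvd_two (F : IntermediateField ℚ E) (hF : Module.finrank ℚ F = 3) :
    P.ramificationIdx (𝓞 F) ∣ 2 := by
  haveI := T5ConjugationDecomposition.isGaloisGroup_gal (F := F) (E := E)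
  have hcard : Nat.card Gal(E/F) = 2 := by
    rw [IsGalois.card_aut_eq_finrank]
    have h1 : Module.finrank ℚ F * Module.finrank F E = Module.finrank ℚ E :=
      Module.finrank_mul_finrank ℚ F E
    have h2 : Module.finrank ℚ E = 6 := by
      rw [IsCyclotomicExtension.finrank (n := 7) E
        (Polynomial.cyclotomic.irreducible_rat (by norm_num))]
      decide
    rw [hF, h2] at h1
    omega
  have := Ideal.ncard_primesOver_mul_ramificationIdxIn_mul_inertiaDegIn (P.under (𝓞 F)) (𝓞 E)
    Gal(E/F)
  rw [hcard, Ideal.ramificationIdxIn_eq_ramificationIdx (P.under (𝓞 F)) P Gal(E/F)] at this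
  refine Dvd.intro (((P.under (𝓞 F)).primesOver (𝓞 E)).ncard *
    (P.under (𝓞 F)).inertiaDegIn (𝓞 E)) ?_
  rw [← this]
  ring

/-- «7 = 𝔭⁶»: for a cubic intermediate field `F` and `𝔭 = P ∩ 𝓞 F`, the tower
`e(P∣7) = e(𝔭∣7)·e(P∣𝔭) = 6` with `e(𝔭∣7) ∣ 3` and `e(P∣𝔭) ∣ 2` forces `e(𝔭∣7) = 3` and
`e(P∣𝔭) = 2`. -/
theorem ramificationIdx_under_of_seven (F : IntermediateField ℚ E) (hF : Module.finrank ℚ F = 3) :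
    (P.under (𝓞 F)).ramificationIdx ℤ = 3 ∧ P.ramificationIdx (𝓞 F) = 2 := by
  have htower : P.ramificationIdx ℤ = (P.under (𝓞 F)).ramificationIdx ℤ * P.ramificationIdx (𝓞 F) :=
    Ideal.ramificationIdx_tower (P.under (𝓞 F)) P
  rw [ramificationIdx_of_seven] at htower
  have h3 : (P.under (𝓞 F)).ramificationIdx ℤ ∣ 3 := by
    have := T5CubicRamification.ramificationIdx_dvd_finrank 7 7 E F (P.under (𝓞 F))
    rwa [hF] at this
  have h2 := ramificationIdx_top_dvd_two P F hF
  rcases (Nat.dvd_prime (by norm_num)).mp h3 with h | h <;>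
    rcases (Nat.dvd_prime (by norm_num)).mp h2 with h' | h'
  · rw [h, h'] at htower
    omega
  · rw [h, h'] at htower
    omega
  · rw [h, h'] at htower
    omega
  · exact ⟨h, h'⟩

end seven

section criteria

variable [IsGalois ℚ E] {p : ℕ} (P : Ideal (𝓞 E)) [P.IsPrime] [P.LiesOver (span {(p : ℤ)})]

/-- THE CRITERION of §N2.6: the inertia group of a prime of `ℚ(ζ₇)` above `p` is trivial iff
`p ≠ 7` («non-trivial iff p ramifies in E; only p = 7 ramifies»). -/
theorem inertia_eq_bot_iff (hp : p.Prime) : P.inertia Gal(E/ℚ) = ⊥ ↔ p ≠ 7 := by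
  constructor
  · intro h hp7
    subst hp7
    exact inertia_ne_bot_of_seven P h
  · intro h7
    exact inertia_eq_bot_of_ne_seven P hp h7

/-- THE CRITERION of §F.1 (iii): for a cubic intermediate field `F`, the place `𝔭 = P ∩ 𝓞 F` is
unramified in `E` iff `p ≠ 7` («the only place of F⁺ ramified in E is the one above 7»). -/
theorem ramificationIdx_under_eq_one_iff (hp : p.Prime) (F : IntermediateField ℚ E)
    (hF : Module.finrank ℚ F = 3) : P.ramificationIdx (𝓞 F) = 1 ↔ p ≠ 7 := by
  constructor
  · intro h hp7
    subst hp7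
    have := (ramificationIdx_under_of_seven P F hF).2
    omega
  · intro h7
    exact (ramificationIdx_under_eq_one_of_ne_seven P hp h7 F).2

end criteria

end Summit.Ventures.HodgeRepro2.T5CyclotomicSevenRamification
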